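import Literature.MathematicalPhysics.QuantumFieldTheory.Balaban1983to89.B7Prop4Flat
import Summits.QuantumFields.BalabanUV.T4Continuum.Support.ShellMeasureLandauFixedPoint

/-!
# `T4Continuum.ShellMeasureSectCFlat` — the Sect. C input (44) + [4] Prop. 7 of row S22 file 2 INSTANTIATED AT THE
# FLAT BACKGROUND from b07's kernel reproduction `B7Prop4Flat` (an EARLIER-PAPER input consumed by name), single level
# (cell `pub-balaban`, sub-cell `t4`, spine estimate NE7c (node U5b); NE7c formalisation swarm, crew seat
# `b2b-balaban-t4-ne7c-formalise-leaf-02` gen 2, OFFERED row S22 file 6; imports `B7Prop4Flat` (unit b2b-balaban-b07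
# gen 17, p. 31/37–39 of [Balaban1985Averaging] reproduced at `U₀ = 1`) and this row's file 2; 0 `def`, 0 sorry)

HONEST FRAMING.  Finite four-torus programme, rung (B)+1 only — NOT infinite volume, NOT a mass gap, NOT the Clay
problem, NOT summit progress; (B), `BetaPertHyp`, (B^μ) not consumed.  NE7c (`T4IndicatorShell.ShellWeightBound`) is
NOT PRINTED and NOT PROVED; «NE7c ⇐ the named binders».  Row S22 file 2 (`ShellMeasureLandauFixedPoint.
landauCorrection_along`) constructs the Landau correction `D` along the contraction ray from two DISPLAYED-TYPE
binders on the nonlinearity `C_j` of the block average ([Balaban1985Variational] (44) «|C_j(LʲηA)| ≦ C₂(Lʲη)²|A|²», by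
reference to [4] = [Balaban1985Averaging] Prop. 4 / Prop. 7): `hCq : ‖Z‖ < R → ‖C Z‖ ≤ C₂‖Z‖²` and
`hCd : DifferentiableOn ℂ C (ball 0 R)`.  The cell's b07 lineage has REPRODUCED [4] Prop. 4 in the kernel AT THE FLAT
BACKGROUND `U₀ = 1` (`B7Prop4Flat`: the `k`-th order average's logarithm `Q_k(1, A)` = `logIter`, its linear part
`L^kη·Q_k(1)A` = `linQIter`, (130)/(135) `‖Q_k − L^kηQ_k(1)A‖ ≤ 8C₁(d)(L^k‖A‖)²` under `8C₁(d)L^k‖A‖ ≤ 1`, and (v1.1 §3)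
the analyticity of `A ↦ C_k(1, A)(c)` on the polydisc `‖A_b‖ < c₄(d)/L^k` of the finite products `𝔸^S`, with EXPLICIT
witnesses `C₂(d) = 8C₁(d) = 10048(d+1)²`, `c₄(d) = 1/(8C₁(d))`).  THIS FILE shows that those kernel facts ARE file 2's
two binders, for the single-level block-average nonlinearity read on finite bond sets:
* §1 `sectC_flat_quad` / `sectC_flat_differentiableOn`: for finite sets `S` (fine bonds carrying the variables, the
  others frozen at the unit — `B7Prop3Flat.insCfg`) and `T` (coarse components), the map
  `𝔸^S → 𝔸^T`, `a ↦ (C_k(1, a)(c))_{c∈T}` satisfies `hCq` with `C₂ := 8C₁(d)·L^{2k}` on `‖a‖ < R := c₄(d)/L^k` (sup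
  norms) and `hCd` there;
* §2 `sectC_flat_quad_scaled` / `sectC_flat_differentiableOn_scaled`: in print's SCALED variable `Z = L^k·a` (the
  «LʲηA» of (44); `B7Prop4Flat`'s dictionary «`L^k‖B_b‖` plays `|A_b|`») the constants are LEVEL-FREE:
  `‖C̃ Z‖ ≤ C₂(d)‖Z‖²` on `‖Z‖ < c₄(d)`, `C̃` holomorphic there (`C̃ Z := C(L^{−k}Z)`);
* §3 `landauCorrection_along_flat`: file 2's `landauCorrection_along` with `hCq`/`hCd` DISCHARGED by §2 — along any
  holomorphic curve of max-normed configurations with `‖Y_σ‖ < ε`, `9C₂(d)B₀ε < 1`, `3ε ≤ c₄(d)`, the Landau correction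
  exists, is unique in the ball `4C₂(d)ε²`, holomorphic, with (55); remaining binders: the scaling `ι`, the (46) bound
  of `H`, the curve.
SCOPE (honest): (i) FLAT background only — [4] Prop. 4 / Prop. 7 at a general small-field `U₀` (what Bałaban uses) is
TYPED in the tree (`B7.Prop4Printed`/`Prop7Printed`), NOT reproduced; (ii) ONE level `k` with plain sup norms — print's
`D` lives on `𝔅_k = ⋃_j Λ_j` with the level-weighted norm |·|_{(−1)} ((51)), a packaging not done here; (iii) `𝔸` any
complete normed ℂ-algebra (print: `𝔤ᶜ`-valued bond variables inside `M_N(ℂ)`).  Value: a cross-lineage junction B7 → B11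
Sect. C → NE7c row S22 in the kernel — an input «from an earlier B_j» consumed BY NAME; nothing of B11–B16 is discharged;
NE7c NOT PROVED.  0 sorry, 0 `def`.  HONEST DEPENDENCY (cell): continuum YM on T⁴ ⇐ BetaPertH ∧ nine spine estimates
(0/9 proved); BetaPertH ⇐ (D1) ∧ (D4) ∧ CAP+tail; G-an2-4 gates asym, D1 and NE2/3/4.
-/

noncomputable section

open Set Metric NormedSpace

namespace Summit.QuantumFields.BalabanUV.T4Continuum.ShellMeasureSectCFlat

open Literature.MathematicalPhysics.QuantumFieldTheory.Balaban1983to89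
open B7Prop1Explicit (Site)
open B7Prop3Flat (insCfg C1 norm_insCfg_le)
open B7Prop4Flat (logIter linQIter c4 C2 C1_pos prop4_flat_induction prop4_flat_Ck_ins smallness_of_le_c4_div
  c4_div_pow_pos)
open ShellMeasureLandauFixedPoint (landauCorrection_along)

variable {d : ℕ} {𝔸 : Type*} [NormedRing 𝔸] [NormedAlgebra ℂ 𝔸] [CompleteSpace 𝔸]

/-! ## §1 The single-level block-average nonlinearity on finite bond sets: (44)'s two binders from `B7Prop4Flat` -/

/-- **(44) AT THE FLAT BACKGROUND, sup norms on `𝔸^S → 𝔸^T`**: for `‖a‖ < c₄(d)/L^k` the remainder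
`C_k(1, a) = Q_k(1, a) − L^kη·Q_k(1)a` read on the coarse components `T` satisfies
`‖C_k(1, a)‖ ≤ 8C₁(d)·L^{2k}·‖a‖²` — `B7Prop4Flat.prop4_flat_induction` (ii) ((130)/(135)) componentwise, packaged in the
sup norm: file 2's binder `hCq` with `C₂ := 8C₁(d)L^{2k}`, `R := c₄(d)/L^k`. [folklore] -/
theorem sectC_flat_quad (S T : Finset (Site d × Fin d)) (L : ℕ) (hL : 2 ≤ L) (k : ℕ) (a : S → 𝔸)
    (ha : ‖a‖ < c4 d / (L : ℝ) ^ k) :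
    ‖(fun t : T => logIter L (insCfg S a) k t.1.1 t.1.2 - linQIter L (insCfg S a) k t.1.1 t.1.2)‖ ≤
      (8 * C1 d * ((L : ℝ) ^ k) ^ 2) * ‖a‖ ^ 2 := by
  have hL1 : 1 ≤ L := le_trans (by norm_num) hL
  have hC1 := C1_pos d
  have hsmall : 8 * C1 d * ((L : ℝ) ^ k * ‖a‖) ≤ 1 := smallness_of_le_c4_div d L hL1 k ha.le
  obtain ⟨-, hE, -⟩ := prop4_flat_induction L hL (insCfg S a) (norm_nonneg a) (fun x κ => norm_insCfg_le S a x κ)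
    k hsmall k le_rfl
  refine (pi_norm_le_iff_of_nonneg (by positivity)).2 fun t => ?_
  calc ‖logIter L (insCfg S a) k t.1.1 t.1.2 - linQIter L (insCfg S a) k t.1.1 t.1.2‖
      ≤ 8 * C1 d * ((L : ℝ) ^ k * ‖a‖) ^ 2 := hE t.1.1 t.1.2
    _ = (8 * C1 d * ((L : ℝ) ^ k) ^ 2) * ‖a‖ ^ 2 := by ring

/-- **[4] PROP. 7's ANALYTICITY AT THE FLAT BACKGROUND, Fréchet on the sup-norm ball**: the same map is complex
differentiable on `ball 0 (c₄(d)/L^k)` of `𝔸^S` — componentwise `B7Prop4Flat.prop4_flat_Ck_ins` (analytic on the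
polydisc, which IS the sup-norm ball), assembled by `differentiableAt_pi`: file 2's binder `hCd`. [folklore] -/
theorem sectC_flat_differentiableOn (S T : Finset (Site d × Fin d)) (L : ℕ) (hL : 2 ≤ L) (k : ℕ) :
    DifferentiableOn ℂ
      (fun a : S → 𝔸 => fun t : T => logIter L (insCfg S a) k t.1.1 t.1.2 - linQIter L (insCfg S a) k t.1.1 t.1.2)
      (ball 0 (c4 d / (L : ℝ) ^ k)) := by
  have hL1 : 1 ≤ L := le_trans (by norm_num) hL
  intro a ha
  have ha' : ∀ s, ‖a s‖ < c4 d / (L : ℝ) ^ k :=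
    (pi_norm_lt_iff (c4_div_pow_pos d L hL1 k)).1 (mem_ball_zero_iff.1 ha)
  have hcomp : ∀ t : T, DifferentiableAt ℂ
      (fun a : S → 𝔸 => logIter L (insCfg S a) k t.1.1 t.1.2 - linQIter L (insCfg S a) k t.1.1 t.1.2) a :=
    fun t => ((prop4_flat_Ck_ins S L hL k t.1.1 t.1.2).1 a ha').differentiableAt
  exact (differentiableAt_pi.2 hcomp).differentiableWithinAt

/-! ## §2 Print's scaled variable `Z = L^k·a`: level-free constants `C₂(d)`, `c₄(d)` -/

omit [CompleteSpace 𝔸] in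
/-- norm of the unscaling `Z ↦ L^{−k}·Z` on `𝔸^S`: `‖L^{−k}Z‖ = L^{−k}‖Z‖`. [folklore] -/
theorem norm_unscale (S : Finset (Site d × Fin d)) (L : ℕ) (k : ℕ) (Z : S → 𝔸) :
    ‖((L : ℂ) ^ k)⁻¹ • Z‖ = ((L : ℝ) ^ k)⁻¹ * ‖Z‖ := by
  rw [norm_smul, norm_inv, norm_pow, Complex.norm_natCast]

/-- **(44) IN THE SCALED VARIABLE, LEVEL-FREE**: `‖C̃ Z‖ ≤ C₂(d)·‖Z‖²` for `‖Z‖ < c₄(d)`, where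
`C̃ Z := C_k(1, L^{−k}Z)` on `T` and `C₂(d) = 8C₁(d)` (`B7Prop4Flat.C2`) — LITERALLY the shape «|C_j(LʲηA)| ≦ C₂(Lʲη)²|A|²»
with `Z = LʲηA`. [folklore] -/
theorem sectC_flat_quad_scaled (S T : Finset (Site d × Fin d)) (L : ℕ) (hL : 2 ≤ L) (k : ℕ) (Z : S → 𝔸)
    (hZ : ‖Z‖ < c4 d) :
    ‖(fun t : T => logIter L (insCfg S (((L : ℂ) ^ k)⁻¹ • Z)) k t.1.1 t.1.2 -
        linQIter L (insCfg S (((L : ℂ) ^ k)⁻¹ • Z)) k t.1.1 t.1.2)‖ ≤ C2 d * ‖Z‖ ^ 2 := by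
  have hL1 : 1 ≤ L := le_trans (by norm_num) hL
  have hLpos : (0 : ℝ) < (L : ℝ) ^ k := by
    have : (0 : ℝ) < L := by exact_mod_cast hL1
    positivity
  have hn := norm_unscale S L k Z
  have ha : ‖((L : ℂ) ^ k)⁻¹ • Z‖ < c4 d / (L : ℝ) ^ k := by
    rw [hn, inv_mul_eq_div]
    exact div_lt_div_of_pos_right hZ hLpos
  have h := sectC_flat_quad S T L hL k (((L : ℂ) ^ k)⁻¹ • Z) ha
  rw [hn] at h
  calc _ ≤ (8 * C1 d * ((L : ℝ) ^ k) ^ 2) * (((L : ℝ) ^ k)⁻¹ * ‖Z‖) ^ 2 := h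
    _ = C2 d * ‖Z‖ ^ 2 := by rw [C2]; field_simp

/-- **[4] PROP. 7 IN THE SCALED VARIABLE**: `C̃` is complex differentiable on `ball 0 (c₄(d))`. [folklore] -/
theorem sectC_flat_differentiableOn_scaled (S T : Finset (Site d × Fin d)) (L : ℕ) (hL : 2 ≤ L) (k : ℕ) :
    DifferentiableOn ℂ
      (fun Z : S → 𝔸 => fun t : T => logIter L (insCfg S (((L : ℂ) ^ k)⁻¹ • Z)) k t.1.1 t.1.2 -
        linQIter L (insCfg S (((L : ℂ) ^ k)⁻¹ • Z)) k t.1.1 t.1.2)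
      (ball 0 (c4 d)) := by
  have hL1 : 1 ≤ L := le_trans (by norm_num) hL
  have hLpos : (0 : ℝ) < (L : ℝ) ^ k := by
    have : (0 : ℝ) < L := by exact_mod_cast hL1
    positivity
  have hmaps : MapsTo (fun Z : S → 𝔸 => ((L : ℂ) ^ k)⁻¹ • Z) (ball (0 : S → 𝔸) (c4 d))
      (ball (0 : S → 𝔸) (c4 d / (L : ℝ) ^ k)) := fun Z hZ => by
    rw [mem_ball_zero_iff] at hZ ⊢
    rw [norm_unscale S L k Z, inv_mul_eq_div]
    exact div_lt_div_of_pos_right hZ hLpos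
  exact (sectC_flat_differentiableOn S T L hL k).comp
    ((differentiable_id.const_smul (((L : ℂ) ^ k)⁻¹)).differentiableOn) hmaps

/-! ## §3 File 2's Landau correction with the Sect. C input DISCHARGED at the flat background -/

/-- **THE LANDAU CORRECTION ALONG A HOLOMORPHIC CURVE, SECT. C INPUT KERNEL (flat background, one level).**
`ShellMeasureLandauFixedPoint.landauCorrection_along` with `C := C̃` (the scaled single-level block-average
nonlinearity on `𝔸^S → 𝔸^T` at `U₀ = 1`), `C₂ := C₂(d)`, `R := c₄(d)` — its binders `hCq`/`hCd` DISCHARGED by §2.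
Remaining binders: the scaling `ι` into `𝔸^S` (`‖ι Y‖ ≤ ‖Y‖`), the operator `H : 𝔸^T → 𝒴` with (46)-TYPE bound `B₀`,
the (54)-smallness `9C₂(d)B₀ε < 1`, `3ε ≤ c₄(d)`, and the curve.  CONCLUSION: a holomorphic `σ ↦ D_σ ∈ 𝔸^T` in the
closed ball `4C₂(d)ε²`, solving (50), unique there, with (55) `‖D_σ‖ ≤ 4C₂(d)‖ι Y_σ‖²`. [folklore] -/
theorem landauCorrection_along_flat (S T : Finset (Site d × Fin d)) (L : ℕ) (hL : 2 ≤ L) (k : ℕ)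
    {𝒴 : Type*} [NormedAddCommGroup 𝒴] [NormedSpace ℂ 𝒴] (ι : 𝒴 →L[ℂ] (S → 𝔸)) (hι : ∀ Y, ‖ι Y‖ ≤ ‖Y‖)
    (H : (T → 𝔸) →L[ℂ] 𝒴) {B₀ : ℝ} (hB₀ : 0 ≤ B₀) (hH : ∀ X, ‖H X‖ ≤ B₀ * ‖X‖) {ε Rad : ℝ}
    (hq : 9 * C2 d * B₀ * ε < 1) (hRC : 3 * ε ≤ c4 d) {Y : ℂ → 𝒴} (hYd : DifferentiableOn ℂ Y (ball 0 Rad))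
    (hY : ∀ σ ∈ ball (0 : ℂ) Rad, ‖Y σ‖ < ε) :
    ∃ Dc : ℂ → (T → 𝔸), DifferentiableOn ℂ Dc (ball 0 Rad) ∧ ∀ σ ∈ ball (0 : ℂ) Rad,
      Dc σ ∈ closedBall (0 : T → 𝔸) (4 * C2 d * ε ^ 2) ∧
      (fun t : T => logIter L (insCfg S (((L : ℂ) ^ k)⁻¹ • (ι (Y σ) - ι (H (Dc σ))))) k t.1.1 t.1.2 -
          linQIter L (insCfg S (((L : ℂ) ^ k)⁻¹ • (ι (Y σ) - ι (H (Dc σ))))) k t.1.1 t.1.2) = Dc σ ∧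
      (∀ X' ∈ closedBall (0 : T → 𝔸) (4 * C2 d * ε ^ 2),
        (fun t : T => logIter L (insCfg S (((L : ℂ) ^ k)⁻¹ • (ι (Y σ) - ι (H X')))) k t.1.1 t.1.2 -
          linQIter L (insCfg S (((L : ℂ) ^ k)⁻¹ • (ι (Y σ) - ι (H X')))) k t.1.1 t.1.2) = X' → X' = Dc σ) ∧
      ‖Dc σ‖ ≤ 4 * C2 d * ‖ι (Y σ)‖ ^ 2 := by
  have hC2 : 0 ≤ C2 d := by
    have := C1_pos d
    rw [C2]; positivity
  exact landauCorrection_along hC2 (fun Z hZ => sectC_flat_quad_scaled S T L hL k Z hZ)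
    (sectC_flat_differentiableOn_scaled S T L hL k) ι hι H hB₀ hH hq hRC hYd hY

end Summit.QuantumFields.BalabanUV.T4Continuum.ShellMeasureSectCFlat
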